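import Summits.HubbardSuperconductivity.HubbardSuperconductivity.Theorems.AnisotropyChordTransferFibre3RowDMTerm

/-!
# Route `AnisotropyChord` / H0 rotor rung, row D (KT-2a) Stage-1 evaluator: the `C0`-FORM (`N`) monomials, closed part EXACT

Layer E of the row-D program (p1 g29 memo ROWD-DESIGN-g29 §6; layers A–D = `…RowDPairs{,Small}`, `…RowDAtoms`, `…RowDPhase`, `…RowDSlots`,
`…RowDClosed`, `…RowDMTerm`).  For a monomial `(Fa, Fb, Fc) = (slot k1, slot k2, slot k3)`, g27's `C0MonoTransform` writes
`cfgDFT[c0form3](k₂,k₃) = −½ Σ_{e ∈ nn} [tconv(F̂c, d_eF̂a, d_eF̂b) + tconv(d_eF̂c, d_{−e}F̂a, F̂b) + tconv(d_eF̂c, F̂a, d_eF̂b)]`; each weighted factor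
is a uniform spec `psiU kind 1 (−1) (±ē)` (★ `dft_slotW`, `SlotSpecs` + `FfacDictionary`), so each `tconv` is `closedPartU + loopPartU`
(`ConvExpansionU`) with exactly TWO weighted slots — patterns `{1,2}`, `{3,1}`, `{3,2}` = `closedN3`, `closedN2`, `closedN1` of `…RowDClosed`.
★ `c0form_split : cfgDFT[c0form3 slots](k₂,k₃) = nClosedU + nLoopU`; ★ `nTermE0 k3 k1 k2 k₂ k₃` (ordinary pair) with
★ `nTermE0_eval : V²·t·peval θ xTrueD (nTermE0 …) = nClosedU … (k̄₂,k̄₃)` under the decidable `nOk k₂ k₃ = true`; the `v`-factor adds the two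
`K₁`-translates (`RowD.cfgDFT_vfun_mul`): ★ `nTermE`, ★ `nTermE_eval` for `cfgDFT[v·c0form3 slots]`'s closed half ★ `nvClosedU`
(split ★ `vc0form_split`).  Loop halves `nLoopU`/`nvLoopU` are majorised in Stage-1b.
Prover seat `hubbard-h0-rotor-p1` g29 (route lead); helper for piece A = stmt-HubbardSuperconductivity-23918 of rung 19089
(`--supports`, helper class).  Nothing here proves superconductivity in the Hubbard model; lemmas for ONE row of ONE conditional reduction;
the rotor TARGET as originally worded stays FALSE (g15 verdict).  Tree imports only; no sorry.
-/

set_option linter.dupNamespace false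
set_option autoImplicit false

open Literature.Analysis.ValidatedNumerics

namespace Summit.HubbardSuperconductivity.HubbardSuperconductivity.Theorems.AnisotropyChord.Transfer.Fibre3

namespace RowD

open RowC L2.N1

variable (L : ℕ) [NeZero L]

/-! ## Weighted slots as uniform specs; the split of one monomial -/

section semantic
variable (Δ lam2 : ℝ) (f : Tor L → ℝ)

/-- ★ `d_e F̂_slot = F_(psiU kind 1 (−1) e)`, `d_e(q) = 1 − e^{−iq·e}` (ground profile, `L ≥ 5`, `0 ≤ Δ < 1`). -/
theorem dft_slotW (hL : 5 ≤ L) (hΔ0 : 0 ≤ Δ) (hΔ1 : Δ < 1) (hf : IsGroundTwoMagnon L Δ lam2 f) (kind : Bool) (e : Tor L) :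
    (fun q => (1 - (starRingEnd ℂ) (phase L q e)) * dft L (slot L Δ f kind) q) = FfacU L lam2 (psiU L Δ lam2 f kind 1 (-1) e) := by
  funext q
  obtain ⟨hJ, hS⟩ := slotSpecs_holds L Δ lam2 f hL hΔ0 hΔ1 hf (some e) q
  have hW : Wfac L (some e) q = 1 - (starRingEnd ℂ) (phase L q e) := rfl
  rw [hW] at hJ hS
  cases kind
  · simp only [slot, psiU, if_false, Bool.false_eq_true]
    rw [hJ, (ffacDictionary_holds L lam2 _ _ _ e q).2]
  · simp only [slot, psiU, if_true]
    rw [hS, (ffacDictionary_holds L lam2 _ _ _ e q).2]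

/-- the closed half of `cfgDFT[c0form3 slots]`. -/
noncomputable def nClosedU (k3 k1 k2 : Bool) (e0 : Tor L) (k₂ k₃ : Tor L) : ℂ :=
  -(1 / 2) * ((nnList L).map (fun e =>
      closedPartU L lam2 (psiU L Δ lam2 f k3 1 0 e0) (psiU L Δ lam2 f k1 1 (-1) e) (psiU L Δ lam2 f k2 1 (-1) e) k₂ k₃
    + closedPartU L lam2 (psiU L Δ lam2 f k3 1 (-1) e) (psiU L Δ lam2 f k1 1 (-1) (-e)) (psiU L Δ lam2 f k2 1 0 e0) k₂ k₃
    + closedPartU L lam2 (psiU L Δ lam2 f k3 1 (-1) e) (psiU L Δ lam2 f k1 1 0 e0) (psiU L Δ lam2 f k2 1 (-1) e) k₂ k₃)).sum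

/-- the loop half of `cfgDFT[c0form3 slots]` (primitives; majorised in Stage-1b). -/
noncomputable def nLoopU (k3 k1 k2 : Bool) (e0 : Tor L) (k₂ k₃ : Tor L) : ℂ :=
  -(1 / 2) * ((nnList L).map (fun e =>
      loopPartU L lam2 (psiU L Δ lam2 f k3 1 0 e0) (psiU L Δ lam2 f k1 1 (-1) e) (psiU L Δ lam2 f k2 1 (-1) e) k₂ k₃
    + loopPartU L lam2 (psiU L Δ lam2 f k3 1 (-1) e) (psiU L Δ lam2 f k1 1 (-1) (-e)) (psiU L Δ lam2 f k2 1 0 e0) k₂ k₃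
    + loopPartU L lam2 (psiU L Δ lam2 f k3 1 (-1) e) (psiU L Δ lam2 f k1 1 0 e0) (psiU L Δ lam2 f k2 1 (-1) e) k₂ k₃)).sum

/-- ★ THE SPLIT: `cfgDFT[c0form3 (slot k1) (slot k2) (slot k3)](k₂,k₃) = nClosedU + nLoopU`. -/
theorem c0form_split (hL : 5 ≤ L) (hΔ0 : 0 ≤ Δ) (hΔ1 : Δ < 1) (hf : IsGroundTwoMagnon L Δ lam2 f)
    (k3 k1 k2 : Bool) (e0 : Tor L) (k₂ k₃ : Tor L) :
    cfgDFT L (fun c => ((c0form3 L (slot L Δ f k1) (slot L Δ f k2) (slot L Δ f k3) c : ℝ) : ℂ)) k₂ k₃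
      = nClosedU L Δ lam2 f k3 k1 k2 e0 k₂ k₃ + nLoopU L Δ lam2 f k3 k1 k2 e0 k₂ k₃ := by
  rw [c0MonoTransform_holds L _ _ _ k₂ k₃]
  have h0 := dft_slot0 L Δ lam2 f hL hΔ0 hΔ1 hf
  have hW := dft_slotW L Δ lam2 f hL hΔ0 hΔ1 hf
  have hsplit : ∀ e : Tor L,
      tconv L (dft L (slot L Δ f k3)) (fun q => (1 - (starRingEnd ℂ) (phase L q e)) * dft L (slot L Δ f k1) q)
          (fun q => (1 - (starRingEnd ℂ) (phase L q e)) * dft L (slot L Δ f k2) q) k₂ k₃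
        + tconv L (fun q => (1 - (starRingEnd ℂ) (phase L q e)) * dft L (slot L Δ f k3) q)
          (fun q => (1 - (starRingEnd ℂ) (phase L q (-e))) * dft L (slot L Δ f k1) q) (dft L (slot L Δ f k2)) k₂ k₃
        + tconv L (fun q => (1 - (starRingEnd ℂ) (phase L q e)) * dft L (slot L Δ f k3) q) (dft L (slot L Δ f k1))
          (fun q => (1 - (starRingEnd ℂ) (phase L q e)) * dft L (slot L Δ f k2) q) k₂ k₃
      = (closedPartU L lam2 (psiU L Δ lam2 f k3 1 0 e0) (psiU L Δ lam2 f k1 1 (-1) e) (psiU L Δ lam2 f k2 1 (-1) e) k₂ k₃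
        + closedPartU L lam2 (psiU L Δ lam2 f k3 1 (-1) e) (psiU L Δ lam2 f k1 1 (-1) (-e)) (psiU L Δ lam2 f k2 1 0 e0) k₂ k₃
        + closedPartU L lam2 (psiU L Δ lam2 f k3 1 (-1) e) (psiU L Δ lam2 f k1 1 0 e0) (psiU L Δ lam2 f k2 1 (-1) e) k₂ k₃)
        + (loopPartU L lam2 (psiU L Δ lam2 f k3 1 0 e0) (psiU L Δ lam2 f k1 1 (-1) e) (psiU L Δ lam2 f k2 1 (-1) e) k₂ k₃
        + loopPartU L lam2 (psiU L Δ lam2 f k3 1 (-1) e) (psiU L Δ lam2 f k1 1 (-1) (-e)) (psiU L Δ lam2 f k2 1 0 e0) k₂ k₃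
        + loopPartU L lam2 (psiU L Δ lam2 f k3 1 (-1) e) (psiU L Δ lam2 f k1 1 0 e0) (psiU L Δ lam2 f k2 1 (-1) e) k₂ k₃) := by
    intro e
    rw [hW k1 e, hW k2 e, hW k3 e, hW k1 (-e), h0 k3 e0, h0 k1 e0, h0 k2 e0,
      convExpansionU_holds L lam2, convExpansionU_holds L lam2, convExpansionU_holds L lam2]
    ring
  unfold nClosedU nLoopU
  simp only [nnList, List.map, List.sum_cons, List.sum_nil, add_zero, hsplit]
  ring

/-- the closed half with the `v`-factor: the three `K₁`-translates. -/
noncomputable def nvClosedU (k3 k1 k2 : Bool) (e0 : Tor L) (k₂ k₃ : Tor L) : ℂ :=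
  nClosedU L Δ lam2 f k3 k1 k2 e0 k₂ k₃ + nClosedU L Δ lam2 f k3 k1 k2 e0 (k₂ - K1 L) k₃ + nClosedU L Δ lam2 f k3 k1 k2 e0 k₂ (k₃ - K1 L)

/-- the loop half with the `v`-factor. -/
noncomputable def nvLoopU (k3 k1 k2 : Bool) (e0 : Tor L) (k₂ k₃ : Tor L) : ℂ :=
  nLoopU L Δ lam2 f k3 k1 k2 e0 k₂ k₃ + nLoopU L Δ lam2 f k3 k1 k2 e0 (k₂ - K1 L) k₃ + nLoopU L Δ lam2 f k3 k1 k2 e0 k₂ (k₃ - K1 L)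

/-- ★ `cfgDFT[v · c0form3 slots](k₂,k₃) = nvClosedU + nvLoopU`. -/
theorem vc0form_split (hL : 5 ≤ L) (hΔ0 : 0 ≤ Δ) (hΔ1 : Δ < 1) (hf : IsGroundTwoMagnon L Δ lam2 f)
    (k3 k1 k2 : Bool) (e0 : Tor L) (k₂ k₃ : Tor L) :
    cfgDFT L (fun c => vfun L c * ((c0form3 L (slot L Δ f k1) (slot L Δ f k2) (slot L Δ f k3) c : ℝ) : ℂ)) k₂ k₃
      = nvClosedU L Δ lam2 f k3 k1 k2 e0 k₂ k₃ + nvLoopU L Δ lam2 f k3 k1 k2 e0 k₂ k₃ := by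
  rw [RowD.cfgDFT_vfun_mul, c0form_split L Δ lam2 f hL hΔ0 hΔ1 hf, c0form_split L Δ lam2 f hL hΔ0 hΔ1 hf,
    c0form_split L Δ lam2 f hL hΔ0 hΔ1 hf]
  unfold nvClosedU nvLoopU
  ring

end semantic

/-! ## The closed half as an `RExpr` pair -/

/-- ★ the closed half of `cfgDFT[c0form3 slots](k̄₂,k̄₃)` divided by `V²t`: `−½ Σ_{e ∈ E4} (closedN3 + closedN2 + closedN1)`. -/
def nTermE0 (k3 k1 k2 : Bool) (k₂ k₃ : ℤ × ℤ) : RExpr × RExpr :=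
  pscale (cst (-1 / 2)) (psum (E4.map fun e =>
    padd (padd (closedN3 k3 k1 k2 e e k₂ k₃) (closedN2 k3 k1 k2 e (-e) k₂ k₃)) (closedN1 k3 k1 k2 e e k₂ k₃)))

/-- ★ with the `v`-factor: the three translates. -/
def nTermE (k3 k1 k2 : Bool) (k₂ k₃ : ℤ × ℤ) : RExpr × RExpr :=
  padd (padd (nTermE0 k3 k1 k2 k₂ k₃) (nTermE0 k3 k1 k2 (k₂ - exI) k₃)) (nTermE0 k3 k1 k2 k₂ (k₃ - exI))

/-- multipliers `|q·e| ≤ 3` for all `e ∈ E4`. -/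
def okMul (q : ℤ × ℤ) : Bool := E4.all fun e => decide ((qdot q e).natAbs ≤ 3)

/-- ★ the decidable side condition of `nTermE0_eval` at `(k₂,k₃)`. -/
def nOk0 (k₂ k₃ : ℤ × ℤ) : Bool :=
  okPair k₂ k₃ && okMul k₂ && okMul k₃ && okMul (k₂ + k₃) && okMul (-k₂)

/-- ★ the side condition of `nTermE_eval` (the three translates). -/
def nOk (k₂ k₃ : ℤ × ℤ) : Bool := nOk0 k₂ k₃ && nOk0 (k₂ - exI) k₃ && nOk0 k₂ (k₃ - exI)

omit [NeZero L] in
/-- reading `okMul`. -/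
theorem okMul_imp {q : ℤ × ℤ} (h : okMul q = true) : ∀ e ∈ E4, (qdot q e).natAbs ≤ 3 := by
  intro e he
  unfold okMul at h
  rw [List.all_eq_true] at h
  exact of_decide_eq_true (h e he)

omit [NeZero L] in
/-- `E4` is closed under negation (for the `d_{−e}` weight). -/
theorem neg_mem_E4 : ∀ e ∈ E4, -e ∈ E4 := by decide

section evals
variable (Δ lam2 : ℝ) (f : Tor L → ℝ)

/-- one `e`-term: `V²·t·peval(closedN3 + closedN2 + closedN1) =` the three closed convolutions. -/
theorem eterm_eval (hL : 7 ≤ L) (hΔ0 : 0 ≤ Δ) (hΔ1 : Δ < 1) (hf : IsGroundTwoMagnon L Δ lam2 f) (hlam : 0 < lam2)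
    (k3 k1 k2 : Bool) (e0 : Tor L) {k₂ k₃ : ℤ × ℤ} (hok : nOk0 k₂ k₃ = true) {e : ℤ × ℤ} (he : e ∈ E4) :
    ((L : ℂ) ^ 2) ^ 2 * ((((2 * Real.pi / L) ^ 2 : ℝ) : ℂ) * peval (2 * Real.pi / L) (xTrueD L Δ lam2 f)
        (padd (padd (closedN3 k3 k1 k2 e e k₂ k₃) (closedN2 k3 k1 k2 e (-e) k₂ k₃)) (closedN1 k3 k1 k2 e e k₂ k₃)))
      = closedPartU L lam2 (psiU L Δ lam2 f k3 1 0 e0) (psiU L Δ lam2 f k1 1 (-1) (B1.toTor L e))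
          (psiU L Δ lam2 f k2 1 (-1) (B1.toTor L e)) (B1.toTor L k₂) (B1.toTor L k₃)
        + closedPartU L lam2 (psiU L Δ lam2 f k3 1 (-1) (B1.toTor L e)) (psiU L Δ lam2 f k1 1 (-1) (-(B1.toTor L e)))
          (psiU L Δ lam2 f k2 1 0 e0) (B1.toTor L k₂) (B1.toTor L k₃)
        + closedPartU L lam2 (psiU L Δ lam2 f k3 1 (-1) (B1.toTor L e)) (psiU L Δ lam2 f k1 1 0 e0)
          (psiU L Δ lam2 f k2 1 (-1) (B1.toTor L e)) (B1.toTor L k₂) (B1.toTor L k₃) := by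
  have hV : ((L : ℂ) ^ 2) ^ 2 ≠ 0 := by
    have : (L : ℂ) ≠ 0 := by exact_mod_cast NeZero.ne L
    positivity
  simp only [nOk0, okPair, Bool.and_eq_true, okPt_iff] at hok
  obtain ⟨⟨⟨⟨⟨⟨⟨h2, h3⟩, h23⟩, hn2⟩, m2⟩, m3⟩, m23⟩, mn2⟩ := hok
  have hne := neg_mem_E4 e he
  have A := closedN3_eval L Δ lam2 f hL hΔ0 hΔ1 hf hlam k3 k1 k2 e0 e e h2 h3 (okMul_imp m2 e he) (okMul_imp m3 e he)
  have B := closedN2_eval L Δ lam2 f hL hΔ0 hΔ1 hf hlam k3 k1 k2 e0 e (-e) h3 h23 (okMul_imp m3 e he)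
    (okMul_imp m23 (-e) hne)
  have C := closedN1_eval L Δ lam2 f hL hΔ0 hΔ1 hf hlam k3 k1 k2 e0 e e hn2 h23 (okMul_imp mn2 e he)
    (okMul_imp m23 e he)
  rw [B1.toTor_neg] at B
  rw [eq_div_iff hV] at A B C
  rw [peval_padd, peval_padd]
  linear_combination A + B + C

/-- ★ `V²·t·peval(nTermE0) = nClosedU(k̄₂,k̄₃)` (ground profile, `L ≥ 7`, `nOk0 k₂ k₃`). -/
theorem nTermE0_eval (hL : 7 ≤ L) (hΔ0 : 0 ≤ Δ) (hΔ1 : Δ < 1) (hf : IsGroundTwoMagnon L Δ lam2 f) (hlam : 0 < lam2)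
    (k3 k1 k2 : Bool) (e0 : Tor L) {k₂ k₃ : ℤ × ℤ} (hok : nOk0 k₂ k₃ = true) :
    ((L : ℂ) ^ 2) ^ 2 * ((((2 * Real.pi / L) ^ 2 : ℝ) : ℂ)
        * peval (2 * Real.pi / L) (xTrueD L Δ lam2 f) (nTermE0 k3 k1 k2 k₂ k₃))
      = nClosedU L Δ lam2 f k3 k1 k2 e0 (B1.toTor L k₂) (B1.toTor L k₃) := by
  have T := fun (e : ℤ × ℤ) (he : e ∈ E4) => eterm_eval L Δ lam2 f hL hΔ0 hΔ1 hf hlam k3 k1 k2 e0 hok he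
  have e1 := T (1, 0) (by decide)
  have e2 := T (-1, 0) (by decide)
  have e3 := T (0, 1) (by decide)
  have e4 := T (0, -1) (by decide)
  have hc : (((cst (-1 / 2)).eval (xTrueD L Δ lam2 f) : ℝ) : ℂ) = -1 / 2 := by
    simp only [cst, RExpr.eval]; push_cast; ring
  unfold nClosedU
  rw [L2.N1.nnList_eq_map]
  simp only [E4, List.map, List.sum_cons, List.sum_nil, add_zero]
  unfold nTermE0
  rw [peval_pscale, peval_psum, hc]
  simp only [E4, List.map, List.sum_cons, List.sum_nil, add_zero]
  linear_combination (-1 / 2 : ℂ) * (e1 + e2 + e3 + e4)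

/-- ★ `V²·t·peval(nTermE) = nvClosedU(k̄₂,k̄₃)` (ground profile, `L ≥ 7`, `nOk k₂ k₃`). -/
theorem nTermE_eval (hL : 7 ≤ L) (hΔ0 : 0 ≤ Δ) (hΔ1 : Δ < 1) (hf : IsGroundTwoMagnon L Δ lam2 f) (hlam : 0 < lam2)
    (k3 k1 k2 : Bool) (e0 : Tor L) {k₂ k₃ : ℤ × ℤ} (hok : nOk k₂ k₃ = true) :
    ((L : ℂ) ^ 2) ^ 2 * ((((2 * Real.pi / L) ^ 2 : ℝ) : ℂ)
        * peval (2 * Real.pi / L) (xTrueD L Δ lam2 f) (nTermE k3 k1 k2 k₂ k₃))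
      = nvClosedU L Δ lam2 f k3 k1 k2 e0 (B1.toTor L k₂) (B1.toTor L k₃) := by
  simp only [nOk, Bool.and_eq_true] at hok
  obtain ⟨⟨h0, h1⟩, h2⟩ := hok
  have e0' := nTermE0_eval L Δ lam2 f hL hΔ0 hΔ1 hf hlam k3 k1 k2 e0 h0
  have e1 := nTermE0_eval L Δ lam2 f hL hΔ0 hΔ1 hf hlam k3 k1 k2 e0 h1
  have e2 := nTermE0_eval L Δ lam2 f hL hΔ0 hΔ1 hf hlam k3 k1 k2 e0 h2
  have ht2 : B1.toTor L k₂ - K1 L = B1.toTor L (k₂ - exI) := by rw [K1_eq_toTor, ← RowC.toTor_sub]; rfl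
  have ht3 : B1.toTor L k₃ - K1 L = B1.toTor L (k₃ - exI) := by rw [K1_eq_toTor, ← RowC.toTor_sub]; rfl
  unfold nvClosedU
  rw [ht2, ht3, ← e0', ← e1, ← e2]
  unfold nTermE
  rw [peval_padd, peval_padd]
  ring

end evals

end RowD

end Summit.HubbardSuperconductivity.HubbardSuperconductivity.Theorems.AnisotropyChord.Transfer.Fibre3
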